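/-
COR-CM (cells pub-hodgecm / pub-hodgecm2, stage 2 of the Hodge ladder) — HM-EQUALITY Δ2, the ONE-THEOREM bridge at the Appendix-C
presentation IN SUMMAND FORM: «[Liu 2021, Thm. 4.18] AS PRINTED (one datum per character) + per-summand identifications (σ, e) + the
proof's map + the CM-class pin + the D-SIDE printed sentences `ω ≠ 0` / multiplicity one ⟹ the package's combined reading r8
`LiuAlbaneseModuleDatum.Thm418Combined res cmCl`» (pin-3 = prover-pub-hodgecm2-pin-3-g2-0; Δ2 / X3 co-owner per COORDINATOR RULINGS
2026-08-21T19:17:21Z and 22:05:29Z).  A pure COMPOSITION BY NAME of item6-p2's `thm418Combined_of_realised_rankOne'` and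
`rankOne_inputs_of_asPrinted_summands` (`Transposition/Item6PlacementJunctionTransport.lean`) at `toThm418Data C (R μ)` (liuC-typer-4's
`AppendixC/Glue.lean`), sequel of `Transposition/Item6PlacementJunctionAppendixC.lean` (p306833 ✔, whose `ψ` was a `ℂ`-linear
EQUIVALENCE of direct sums and whose `hnv`/`hmult` were typed on the record's pieces).  Theorems only: no definition, no instance, no
named fact, no `variable`, no proof holes; nothing landed is edited or restated.  FRAMING: HC_CM is NOT proved; this file discharges no
COR-CM binder and no pin.
-/
import Summits.HodgeConjecture.CorCM.B01.Transposition.Item6PlacementJunctionTransport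
import Literature.NumberTheory.Automorphic.Liu2021.AppendixC.Glue
import Literature.NumberTheory.Automorphic.Liu2021.Thm418BlockLeRange
import HarnessLib

set_option autoImplicit false

/-!
# Δ2 in one theorem, summand form: `Thm418AsPrintedC C (R μ)` + (σ, e) + (J) + (C) + D-side `hnv`/`hmult` ⟹ `T.Thm418Combined res cmCl`

Compared with `LiuAlbaneseModuleDatum.thm418Combined_of_thm418AsPrintedC` (p306833 ✔) three binders change shape, following item6-p2's
transport file (pin-3 «yes», pub-hodgecm2/INBOX 2026-08-21T21:59:51Z):
* (Ω) the summand identification is PER SUMMAND and need NOT be surjective: an injective index map `σ μ : T.Adm μ → AdmIndex` and, for each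
  piece, a `ℂ`-linear isomorphism `e μ a : T.Ω μ a ≃ ω(μ, σ a)` intertwining the `𝔾(𝔸_F^∞)`-actions (`he`) — the honest shape at the
  package instance, where the record's pieces at an index LINE `i` carry ONE `ε` (the line's) while Liu's direct sum in Thm. 4.18 runs
  over ALL `μ`-admissible `(ε, χ)` (X3 item «`ω(μ,ε,χ) ↔ (line i).Ω ιV χ`» of HM-DELTA2-CLARITY §1; b01-idea-1's row (Ω-i));
* `hnvD` — «every `ω(μ,ε,χ)` is non-zero» ON LIU'S SUMMANDS (Def. 4.11 «irreducible admissible», l. 2092–2096, with App. D Lem. D.1 (1);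
  tree record `Liu2021/LemD1AsPrinted.lean`, shape `Thm418Data.nontrivial_omega_of_localOscillator`), transported to the record's pieces
  by item6-p2's `nontrivial_Ω_of_summand_equiv`;
* `hmultD` — MULTIPLICITY ONE ON LIU'S SUMMANDS in the RECORD's currency, `Module.rank ℂ (IntertwiningMap ω_i (ofModule' H)) ≤ 1`
  (proof of Prop. 4.13, l. 2145; = `Prop413Data.MultOneAsPrinted.rank_intertwiningMap_le_one` at the pin `P.rhoB τ' := ofModule' T.H`,
  tr-prover-6's M1 record p302689), moved to `ℂ[G]`-linear maps by tr-prover-6's `rank_linearMap_asModule_le_rank_intertwiningMap_ofModule'`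
  and to the record's pieces by item6-p2's `rank_hom_le_one_of_summand_equiv`.
Everything else — the record `T` over `𝔾(𝔸_F^∞) = P5.G`, `res`/`cmCl`, the levels `Kof` (`hmono`/`hoc`/`hcof`), ONE §4.2 datum
`C : Sec42Data P5 iso`, the family `R μ : Thm418Rest C`, THE CITE `hLiu μ : Thm418AsPrintedC C (R μ)` ([Liu2021] Thm. 4.18 EXACTLY AS
PRINTED, l. 2232–2245), the proof's map `J μ` with `hJ`/`hJinj` (l. 2247–2268; records `Thm418ProofMapAsPrinted` / `Map43Injective`), the
object `Dμ μ` (Prop. 4.6 (1)) and the CM-class pin `hpin μ` (Lem. 2.4 (1) l. 1210–1213 + functoriality + the `cmCl` contract) — is as in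
p306833.  KERNEL: `thm418Combined_of_realised_rankOne' (fun μ hμ ↦ rankOne_inputs_of_asPrinted_summands (toThm418Data C (R μ hμ)) …)`;
the Appendix-C presentation makes every `toThm418Data C (R μ hμ)` share the group `P5.G` by `rfl`.  At the port instance
(`P5 := honestP5Of h …`, `T := (liuDictionaryPin …).toLiuAlbaneseModuleDatum`, `res := T.res`, `cmCl := T.cmClasses`) the conclusion is
LITERALLY `LiuDictionary.Thm418C` (package `Model/LiuDictionary.lean` :210).  WHAT REMAINS of Δ2: the instance pins (X1: `J`; X3: `R`,
`σ`/`e`, and the `T.H = Tower` codomain of `J`; the `adm` contract inside `hpin`) and the port.  HC_CM is NOT proved.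

References: Y. Liu, arXiv:2102.11518 = Camb. J. Math. 9 (2021) (`FJcycle.tex` md5 6db49a74122d): Lem. 2.4 l. 1210–1213, Def. 4.5
l. 1936–1964, Prop. 4.6 (1) l. 1969, §4.2 l. 2053–2074, Def. 4.11 l. 2083–2097, Prop. 4.13 l. 2113–2119 (proof l. 2145), Thm. 4.18
l. 2232–2245 (proof l. 2247–2268), App. C Prop. C.5 l. 4624–4637, App. D Lem. D.1.
-/

noncomputable section

open scoped DirectSum TensorProduct

namespace HodgeCM.Literature.Theta

namespace LiuAlbaneseModuleDatum

open Literature.NumberTheory.Automorphic.Liu2021 Literature.NumberTheory.Automorphic.Liu2021.AppendixC NumberField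

universe v w

/-- **Δ2 IN ONE THEOREM, SUMMAND FORM — [Liu2021, Thm. 4.18] AS PRINTED at the Appendix-C datum (one `Thm418Rest` per character) +
per-summand identifications + the proof's realisation + the D-side printed sentences ⟹ the package's combined reading r8
`T.Thm418Combined res cmCl`** (= `LiuDictionary.Thm418C` at `res := T.res`, `cmCl := T.cmClasses`).  Binders: `T` over `𝔾(𝔸_F^∞) = P5.G`
with `res`/`cmCl`; levels `Kof` (`hmono`, `hoc`, `hcof` — «sufficiently small», l. 2060/2239); ONE §4.2 datum `C` (l. 2053–2074); per `μ`
with `τ' ∈ Φ_μ`: `R μ` (Def. 4.5 (2) l. 1944–1952, Def. 4.11, Def. 4.16), `hLiu μ` = Thm. 4.18 EXACTLY AS PRINTED (l. 2232–2245) for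
`toThm418Data C (R μ)`, (Ω) `σ μ` injective (`hσ`) with `e μ a : T.Ω μ a ≃ ω(μ, σ a)` equivariant (`he`), (J) `J μ` with `hJ` (l. 2250) and
`hJinj` (reading of l. 2250–2268), `Dμ μ` (Prop. 4.6 (1)), (C) `hpin μ` (Lem. 2.4 (1) l. 1210–1213), `hnvD μ` (Def. 4.11 / Lem. D.1 (1)) and
`hmultD μ` (proof of Prop. 4.13, l. 2145) ON LIU'S SUMMANDS.  KERNEL: item6-p2's `thm418Combined_of_realised_rankOne'` ∘
`rankOne_inputs_of_asPrinted_summands`, per `μ`, at `D := toThm418Data C (R μ hμ)` (group `P5.G` by `rfl`).  HC_CM is NOT proved; no pin is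
discharged here; nothing is asserted about Liu's objects.
[cite: Liu2021, Thm. 4.18 (FJcycle.tex l. 2232–2245) with proof l. 2247–2268, Thm. 4.18 (1) (l. 2239), Lem. 2.4 (1) (l. 1210–1213), Prop. 4.13 proof l. 2145, Def. 4.11, App. D Lem. D.1 (1), §4.2 l. 2053–2074, Prop. C.5 (l. 4624–4637)] -/
theorem thm418Combined_of_thm418AsPrintedC_summands
    {F E : Type} [Field F] [NumberField F] [IsTotallyReal F] [Field E] [NumberField E] [Algebra F E]
    [IsTotallyComplex E] [Algebra.IsQuadraticExtension F E]
    {P5 : PropC5Data F E} {isotropicAt : ℕ → Prop} (C : Sec42Data P5 isotropicAt)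
    {Lvl : Type v} [Preorder Lvl] {Kof : Lvl → Subgroup P5.G} (T : LiuAlbaneseModuleDatum P5.G Kof)
    {W : Lvl → Type w} [∀ K, AddCommGroup (W K)] [∀ K, Module ℂ (W K)]
    (res : ∀ K : Lvl, T.H →ₗ[ℂ] W K) (cmCl : ∀ K : Lvl, T.Char → Set (W K))
    (hmono : ∀ ⦃K K' : Lvl⦄, K ≤ K' → Kof K ≤ Kof K') (hoc : ∀ K : Lvl, IsOpenCompact (Kof K))
    (hcof : ∀ K₀ : Subgroup P5.G, IsOpenCompact K₀ → ∃ K₁ : Lvl, Kof K₁ ≤ K₀)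
    (R : ∀ μ : T.Char, T.PhiMu μ → Thm418Rest C)
    (hLiu : ∀ (μ : T.Char) (hμ : T.PhiMu μ), Thm418AsPrintedC C (R μ hμ))
    (σ : ∀ (μ : T.Char) (hμ : T.PhiMu μ), T.Adm μ → (toThm418Data C (R μ hμ)).AdmIndex)
    (hσ : ∀ (μ : T.Char) (hμ : T.PhiMu μ), Function.Injective (σ μ hμ))
    (e : ∀ (μ : T.Char) (hμ : T.PhiMu μ) (a : T.Adm μ), T.Ω μ a ≃ₗ[ℂ] (toThm418Data C (R μ hμ)).omegaAt (σ μ hμ a))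
    (he : ∀ (μ : T.Char) (hμ : T.PhiMu μ) (a : T.Adm μ) (g : P5.G) (m : T.Ω μ a),
      e μ hμ a (MonoidAlgebra.of ℂ P5.G g • m) = (toThm418Data C (R μ hμ)).rhoAt (σ μ hμ a) g (e μ hμ a m))
    (J : ∀ (μ : T.Char) (hμ : T.PhiMu μ),
      ℂ ⊗[fieldOfValues E (toThm418Data C (R μ hμ)).μ] (toThm418Data C (R μ hμ)).Ω →ₗ[ℂ] T.H)
    (hJinj : ∀ (μ : T.Char) (hμ : T.PhiMu μ), Function.Injective (J μ hμ))
    (hJ : ∀ (μ : T.Char) (hμ : T.PhiMu μ) (g : P5.G) (x : ℂ ⊗[fieldOfValues E (toThm418Data C (R μ hμ)).μ] (toThm418Data C (R μ hμ)).Ω),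
      J μ hμ (((toThm418Data C (R μ hμ)).rhoΩ g).baseChange ℂ x) = MonoidAlgebra.of ℂ P5.G g • J μ hμ x)
    (Dμ : ∀ (μ : T.Char) (hμ : T.PhiMu μ), (toThm418Data C (R μ hμ)).Obj)
    (hpin : ∀ (μ : T.Char) (hμ : T.PhiMu μ) (K : Lvl) (φ : (toThm418Data C (R μ hμ)).HomK (Kof K) (Dμ μ hμ)),
      res K (J μ hμ ((1 : ℂ) ⊗ₜ[fieldOfValues E (toThm418Data C (R μ hμ)).μ] (toThm418Data C (R μ hμ)).res (Kof K) (Dμ μ hμ) φ))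
        ∈ cmCl K μ)
    (hnvD : ∀ (μ : T.Char) (hμ : T.PhiMu μ) (i : (toThm418Data C (R μ hμ)).AdmIndex),
      Nontrivial ((toThm418Data C (R μ hμ)).omegaAt i))
    (hmultD : ∀ (μ : T.Char) (hμ : T.PhiMu μ) (i : (toThm418Data C (R μ hμ)).AdmIndex),
      Module.rank ℂ (Representation.IntertwiningMap ((toThm418Data C (R μ hμ)).rhoAt i)
        (Representation.ofModule' (k := ℂ) (G := P5.G) T.H)) ≤ 1) :
    T.Thm418Combined res cmCl :=
  thm418Combined_of_realised_rankOne' fun μ hμ =>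
    rankOne_inputs_of_asPrinted_summands (toThm418Data C (R μ hμ)) (T := T) (hLiu μ hμ) hmono hoc hcof (σ μ hμ) (hσ μ hμ)
      (e μ hμ) (he μ hμ) (J μ hμ) (hJinj μ hμ) (hJ μ hμ) (Dμ μ hμ) (hpin μ hμ) (hnvD μ hμ) fun i => by
        -- multiplicity one in the record's currency (bundled intertwining maps into `ofModule' H`, tr-prover-6's bridge) ⟹ the
        -- `ℂ[G]`-linear-map currency of item6-p2's transport; the record `T` lives over `P5.G = (toThm418Data C (R μ hμ)).G` (`rfl`)
        letI : Module (MonoidAlgebra ℂ (toThm418Data C (R μ hμ)).G) T.H := T.instH₃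
        haveI : IsScalarTower ℂ (MonoidAlgebra ℂ (toThm418Data C (R μ hμ)).G) T.H := T.instH₄
        exact (Thm418Data.rank_linearMap_asModule_le_rank_intertwiningMap_ofModule' (H := T.H) i).trans (hmultD μ hμ i)

end LiuAlbaneseModuleDatum

end HodgeCM.Literature.Theta

end
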